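import Summits.BirchSwinnertonDyer.BirchSwinnertonDyer.Theorems.ByReductionTypeAtTwoMultTowerNS2CoinvariantsCount
import HarnessLib

/-!
# Route `ByReductionTypeAtTwo`, crux `MultUpperHalfAtTwo` (item stmt-BirchSwinnertonDyer-19922), TOWER road, NON-SPLIT rows:
# the ORDER of the local tower kernel at a non-split multiplicative `2`, part 1 — `2^k`-torsion coinvariant classes of the
# twisted Tate module of unit exponent are coboundaries with an `F_n`-rational norm (C3 at every `2`-power exponent)

HONEST FRAMING (cell `bsd-2adic`, run/shared/lean/pub/bsd-2adic/, seat `bsd-2adic-tower-1` GEN 27, HUMAN RULINGS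
D-0036 / D-0054 / D-0074): TOOL theorems only (no definition, no named fact, no `sorry`); closes nothing by itself;
nothing booked; BSD is not proved by any of this. First module of the KERNEL PROOF of the PRINT binder
`hNS2 = Greenberg1999.sec3_natCard_localTowerKerPrimary_le_four_nonsplitMultiplicative_two` (Greenberg, LNM 1716, §3
p. 93: at a NON-SPLIT multiplicative `v ∣ 2`, `|ker(r_{v_n})| ∼ 2c_v ≤ 4` at every layer of the cyclotomic `ℤ₂`-tower of
`ℚ`) — the ORDER bound `#𝒦_{v,n}[2^∞] ≤ 4` itself, of which GEN 10's
`MultTowerNS2.twoTorsion_localTowerKerPrimary_le_four_nonsplitTwo` (`…MultTowerNS2TwoBit.lean`) is the `2`-torsion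
projection. The road is GEN 9/10's count on the twisted Tate module, run on `2^k`-TORSION coinvariant classes instead of
`2`-torsion ones; the only step that changes is C3 (`exists_coboundary_of_sq_eq`, `…MultTowerNS2CoinvariantsUnit.lean`),
generalised here.

Setting as in BRICKs 15/16: `v ∋ 2`, `K = ℚ_v`, the local layer subgroups `H_m` of the cyclotomic `ℤ₂`-tower and
`H_∞`, an element `t` with `σ t = ±t`, a flip `τ₀ ∈ H_∞`, `g ∈ H_n` fixing `t` with `κ(res g) = 2^n u_g`, a
`Γ`-fixed non-zero `Q ∈ K̄` no power of which is `1`; `T = {x ∈ K̄^{H_∞ ∩ Stab(t)} : τ₀x · x ∈ Q^ℤ}`,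
`B = Q^ℤ · (g−1)T`, `N_R(w) = ∏_{i<2^R} g^i w`.

* `pow_smul_eq_of_smul_eq`, `pow_two_pow_add_smul_eq`, `prod_smul_range_two_pow_add_eq_pow` — orbit products along the tower:
  `N_{R+k}(w) = N_R(w)^{2^k}` when `g^{2^R}` fixes `w`;
* `smul_mul_zpow_inv_pow` — normalising an even-exponent `m`-torsion datum `x^m = Q^j · gz/z` to the unit circle;
* `exists_coboundary_of_pow_eq` — **C3 at exponent `2^k`**: if `x ∈ K̄^{H_∞ ∩ Stab(t)}` with `τ₀x · x = 1` has
  `x^{2^k} = Q^j · gz/z` (`z ∈ T`), then `j = 0`, `N_{R+k}(x) = N_R(x)^{2^k} = 1` at a common finite level `n + R`,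
  and by the cyclic Hilbert 90 of BRICK 16a `x = g(y)/y` with `y ∈ K̄^{H_∞ ∩ Stab(t)}`, `y ≠ 0`, whose norm
  `y · τ₀y` is a NON-ZERO ELEMENT OF `F_n` (fixed by all of `H_n`) — verbatim the conclusion of C3.

References: R. Greenberg, LNM 1716 (1999), §3 pp. 85–93 (the passage between Prop. 3.6 and Prop. 3.7, p. 93);
J. Neukirch, *ANT* IV (3.5); cell memos SCOPE-hNS2one-kernel-GEN8.md (S3–S6), NOTE-NS2-GALOIS-ACTION-GEN14.md.
-/

set_option autoImplicit false
-- the Theorems namespace of this sub repeats the summit name by design (D-0017 nested layout: Summit.<S>.<Sub>)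
set_option linter.dupNamespace false

noncomputable section

open scoped Classical IntermediateField

namespace Summit.BirchSwinnertonDyer.BirchSwinnertonDyer.Theorems.MultTowerNS2

open NumberField IsDedekindDomain Field PadicInt Literature.NumberTheory.EllipticCurves
  Literature.NumberTheory.GaloisRepresentations

variable {κ : ZpExtension ℚ 2}

/-! ### Orbit products along the tower: `N_{R+k}(w) = N_R(w)^{2^k}` -/

/-- If `h` fixes `w` then so does every power of `h`. [folklore] -/
theorem pow_smul_eq_of_smul_eq {K : Type*} [Field K] (h : absoluteGaloisGroup K) {w : AlgebraicClosure K}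
    (hw : h • w = w) (m : ℕ) : (h ^ m) • w = w := by
  induction m with
  | zero => rw [pow_zero, one_smul]
  | succ m ih => rw [pow_succ, mul_smul, hw, ih]

/-- If `g^{2^R}` fixes `w` then so does `g^{2^{R+k}}`. [folklore] -/
theorem pow_two_pow_add_smul_eq {K : Type*} [Field K] (g : absoluteGaloisGroup K) (R k : ℕ)
    {w : AlgebraicClosure K} (hw : (g ^ 2 ^ R) • w = w) : (g ^ 2 ^ (R + k)) • w = w := by
  rw [pow_add, pow_mul]
  exact pow_smul_eq_of_smul_eq (g ^ 2 ^ R) hw (2 ^ k)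

/-- **`N_{R+k}(w) = N_R(w)^{2^k}` when `g^{2^R} w = w`** (splitting the range `[0, 2^{R+k})` into `2^k` translates of
`[0, 2^R)`, each contributing `N_R(w)`). [folklore] -/
theorem prod_smul_range_two_pow_add_eq_pow {K : Type*} [Field K] (g : absoluteGaloisGroup K) (R k : ℕ)
    {w : AlgebraicClosure K} (hw : (g ^ 2 ^ R) • w = w) :
    (∏ i ∈ Finset.range (2 ^ (R + k)), (g ^ i) • w) = (∏ i ∈ Finset.range (2 ^ R), (g ^ i) • w) ^ 2 ^ k := by
  induction k with
  | zero => rw [add_zero, pow_zero, pow_one]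
  | succ k ih =>
    have hfix : (g ^ 2 ^ (R + k)) • w = w := pow_two_pow_add_smul_eq g R k hw
    rw [show R + (k + 1) = (R + k) + 1 by ring, pow_succ, mul_comm, prod_smul_range_two_mul,
      pow_smul_prod_smul_eq g (2 ^ (R + k)) hfix, ih, ← sq, ← pow_mul, ← pow_succ]

/-! ### Normalising an even-exponent `m`-torsion datum -/

/-- **Normalising an element of even exponent to the unit circle, `m`-torsion form.** If `τ₀x·x = Q^{2c}` then
`x' = x·Q^{-c}` is still fixed by `H_∞ ∩ Stab(t)`, satisfies `τ₀x'·x' = 1`, and `x'^m = Q^{j - m c}·gz/z` whenever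
`x^m = Q^j·gz/z`. [cite: GreenbergLNM1716, §3 (pp. 87–89)] -/
theorem smul_mul_zpow_inv_pow (v : HeightOneSpectrum (𝓞 ℚ)) {g τ₀ : absoluteGaloisGroup (v.adicCompletion ℚ)}
    {t Q x z : AlgebraicClosure (v.adicCompletion ℚ)}
    (hQfix : ∀ σ : absoluteGaloisGroup (v.adicCompletion ℚ), σ • Q = Q) (hQ0 : Q ≠ 0)
    (hxL : ∀ h ∈ localSubgroup κ.kerSubgroup (v.adicCompletion ℚ), h • t = t → h • x = x)
    {c : ℤ} (hxc : τ₀ • x * x = Q ^ (2 * c)) (m : ℕ) {j : ℤ} (hxm : x ^ m = Q ^ j * (g • z / z)) :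
    (∀ h ∈ localSubgroup κ.kerSubgroup (v.adicCompletion ℚ), h • t = t → h • (x * (Q ^ c)⁻¹) = x * (Q ^ c)⁻¹) ∧
      τ₀ • (x * (Q ^ c)⁻¹) * (x * (Q ^ c)⁻¹) = 1 ∧
      (x * (Q ^ c)⁻¹) ^ m = Q ^ (j - m * c) * (g • z / z) := by
  have hQc : Q ^ c ≠ 0 := zpow_ne_zero _ hQ0
  refine ⟨fun h hh hht ↦ by rw [smul_mul', smul_inv'', smul_zpow₀', hQfix, hxL h hh hht], ?_, ?_⟩
  · rw [smul_mul', smul_inv'', smul_zpow₀', hQfix]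
    field_simp
    rw [hxc, two_mul, zpow_add₀ hQ0]
    exact (sq _).symm
  · rw [mul_pow, hxm, inv_pow, ← zpow_natCast (Q ^ c), ← zpow_mul, zpow_sub₀ hQ0]
    ring

/-! ### C3 at exponent `2^k`: unit `2^k`-torsion classes are coboundaries with an `F_n`-rational norm -/

/-- **C3 at exponent `2^k` (scope S3/S6).** Let `x ∈ K̄^{H_∞ ∩ Stab(t)}` with `τ₀x · x = 1` and
`x^{2^k} = Q^j · gz/z` for some `z` of the twisted Tate module (`z ≠ 0` in `K̄^{H_∞ ∩ Stab(t)}` with `τ₀z · z ∈ Q^ℤ`).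
Then `x = g(y)/y` for some non-zero `y ∈ K̄^{H_∞ ∩ Stab(t)}` whose norm `y · τ₀y` is non-zero and fixed by ALL of `H_n`
(an element of `F_n`). Proof: the exponent count gives `j = 0`; at a common finite level `n + R` one has
`N_R(x)^{2^k} = N_R(gz)/N_R(z) = 1`, so `N_{R+k}(x) = N_R(x)^{2^k} = 1` and the cyclic Hilbert 90 of BRICK 16a applies
at level `n + R + k`; `g(y τ₀y) = (xy)·τ₀(xy) = y τ₀y`, `τ₀(y τ₀ y) = y τ₀ y`, and `H_n` is generated by
`H_{n+R+k} ∩ Stab(t)`, `τ₀` and `g` (BRICK 15). The case `k = 1` is C3 (`exists_coboundary_of_sq_eq`).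
[cite: GreenbergLNM1716, §3 (pp. 87–93)] [cite: NeukirchANT1999, Ch. IV (3.5)] -/
theorem exists_coboundary_of_pow_eq (v : HeightOneSpectrum (𝓞 ℚ))
    (n : ℕ) {g : absoluteGaloisGroup (v.adicCompletion ℚ)} {ug : ℤ_[2]ˣ}
    (hug : ((κ (resGal (K := ℚ) (v.adicCompletion ℚ) g)).toAdd : ℤ_[2]) = 2 ^ n * (ug : ℤ_[2]))
    {t : AlgebraicClosure (v.adicCompletion ℚ)}
    (ht : ∀ σ : absoluteGaloisGroup (v.adicCompletion ℚ), σ • t = t ∨ σ • t = -t) (hgt : g • t = t)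
    {τ₀ : absoluteGaloisGroup (v.adicCompletion ℚ)} (hτ₀ : τ₀ ∈ localSubgroup κ.kerSubgroup (v.adicCompletion ℚ))
    (hτ₀t : τ₀ • t = -t) {Q : AlgebraicClosure (v.adicCompletion ℚ)}
    (hQfix : ∀ σ : absoluteGaloisGroup (v.adicCompletion ℚ), σ • Q = Q) (hQ0 : Q ≠ 0)
    (hQtor : ∀ j : ℤ, Q ^ j = 1 → j = 0)
    {x : AlgebraicClosure (v.adicCompletion ℚ)}
    (hxL : ∀ h ∈ localSubgroup κ.kerSubgroup (v.adicCompletion ℚ), h • t = t → h • x = x) (hxU : τ₀ • x * x = 1)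
    (k : ℕ) {j : ℤ} {z : AlgebraicClosure (v.adicCompletion ℚ)} (hz0 : z ≠ 0)
    (hzL : ∀ h ∈ localSubgroup κ.kerSubgroup (v.adicCompletion ℚ), h • t = t → h • z = z)
    {j' : ℤ} (hzj : τ₀ • z * z = Q ^ j') (hxk : x ^ 2 ^ k = Q ^ j * (g • z / z)) :
    ∃ y : AlgebraicClosure (v.adicCompletion ℚ), y ≠ 0 ∧
      (∀ h ∈ localSubgroup κ.kerSubgroup (v.adicCompletion ℚ), h • t = t → h • y = y) ∧ x = g • y / y ∧
      y * τ₀ • y ≠ 0 ∧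
      ∀ h ∈ localSubgroup (κ.layerSubgroup n) (v.adicCompletion ℚ), h • (y * τ₀ • y) = y * τ₀ • y := by
  -- normality of the local subgroups
  haveI hHin : (localSubgroup κ.kerSubgroup (v.adicCompletion ℚ)).Normal := by
    rw [localSubgroup_eq_comap]; exact Subgroup.Normal.comap inferInstance _
  have hHmn : ∀ m, (localSubgroup (κ.layerSubgroup m) (v.adicCompletion ℚ)).Normal := fun m ↦ by
    rw [localSubgroup_eq_comap]; exact Subgroup.Normal.comap inferInstance _
  have hile : ∀ m, localSubgroup κ.kerSubgroup (v.adicCompletion ℚ) ≤ localSubgroup (κ.layerSubgroup m) (v.adicCompletion ℚ) :=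
    fun m τ hτ ↦ by
      rw [mem_localSubgroup_iff] at hτ ⊢
      exact κ.kerSubgroup_le_layerSubgroup m hτ
  have hgit : ∀ i : ℕ, (g ^ i) • t = t := fun i ↦ pow_smul_eq_of_smul_eq g hgt i
  -- (1) `j = 0`
  have hgz0 : g • z ≠ 0 := (smul_ne_zero_iff_ne g).mpr hz0
  have hcob : τ₀ • (g • z / z) * (g • z / z) = 1 :=
    flip_smul_coboundary_mul_coboundary ht hτ₀ hτ₀t hgt hQ0 (hQfix g) hz0 hzL hzj
  have hj : j = 0 := by
    have h1 : τ₀ • (x ^ 2 ^ k) * x ^ 2 ^ k = 1 := by rw [smul_pow', ← mul_pow, hxU, one_pow]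
    rw [hxk, smul_mul', smul_zpow₀', hQfix τ₀] at h1
    have h2 : Q ^ (2 * j) = 1 := by
      rw [two_mul, zpow_add₀ hQ0]
      linear_combination (-(Q ^ j * Q ^ j)) * hcob + h1
    have := hQtor _ h2
    omega
  rw [hj, zpow_zero, one_mul] at hxk
  -- (2) a common finite level `n + R` for `x` and `z`
  obtain ⟨R, hxR, hzR⟩ := exists_forall_mem_localSubgroup_layerSubgroup_add_smul_eq₂ (κ := κ) v n t x z hxL hzL
  have hgRmem : g ^ 2 ^ R ∈ localSubgroup (κ.layerSubgroup (n + R)) (v.adicCompletion ℚ) :=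
    (pow_mem_localSubgroup_layerSubgroup_iff (κ := κ) v n R hug _).mpr dvd_rfl
  have hgRx : (g ^ 2 ^ R) • x = x := hxR _ hgRmem (hgit _)
  have hgRz : (g ^ 2 ^ R) • z = z := hzR _ hgRmem (hgit _)
  -- (3) `N_R(x)^{2^k} = 1`, hence `N_{R+k}(x) = 1`
  have hprodz : (∏ i ∈ Finset.range (2 ^ R), (g ^ i) • (g • z / z)) = 1 := by
    rw [Finset.prod_congr rfl fun i _ ↦ show (g ^ i) • (g • z / z) = (g ^ i) • (g • z) * (g ^ i) • z⁻¹ by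
        rw [div_eq_mul_inv, smul_mul'], Finset.prod_mul_distrib, prod_smul_smul_eq g (2 ^ R) hgRz, prod_smul_inv,
      mul_inv_cancel₀]
    exact Finset.prod_ne_zero_iff.mpr fun i _ ↦ (smul_ne_zero_iff_ne _).mpr hz0
  have hNRk : (∏ i ∈ Finset.range (2 ^ R), (g ^ i) • x) ^ 2 ^ k = 1 := by
    rw [← Finset.prod_pow, Finset.prod_congr rfl fun i _ ↦ (smul_pow' (g ^ i) x (2 ^ k)).symm, hxk, hprodz]
  have hNR1 : (∏ i ∈ Finset.range (2 ^ (R + k)), (g ^ i) • x) = 1 := by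
    rw [prod_smul_range_two_pow_add_eq_pow g R k hgRx, hNRk]
  -- (4) cyclic Hilbert 90 at level `n + R + k`
  have hxRk : ∀ h ∈ localSubgroup (κ.layerSubgroup (n + (R + k))) (v.adicCompletion ℚ), h • t = t → h • x = x :=
    fun h hh hht ↦ hxR h (localSubgroup_layerSubgroup_le_of_le v (by omega) hh) hht
  obtain ⟨y, hy0, hyR, hxy⟩ := exists_eq_smul_div_of_prod_smul_eq_one (κ := κ) v n (R + k) hug ht hgt hxRk hNR1
  have hyL : ∀ h ∈ localSubgroup κ.kerSubgroup (v.adicCompletion ℚ), h • t = t → h • y = y :=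
    fun h hh hht ↦ hyR h (hile _ hh) hht
  have hτy0 : τ₀ • y ≠ 0 := (smul_ne_zero_iff_ne τ₀).mpr hy0
  have hgy : g • y = x * y := by rw [hxy, div_mul_cancel₀ _ hy0]
  -- (5) the norm `y · τ₀ y` is fixed by `g`, by `τ₀`, by `H_{n+R+k} ∩ Stab(t)`, hence by `H_n`
  haveI := hHmn (n + (R + k))
  have hgv : g • (y * τ₀ • y) = y * τ₀ • y := by
    rw [smul_mul', ← flip_smul_smul_comm ht hτ₀ hτ₀t hgt hyL, hgy, smul_mul']
    linear_combination (y * τ₀ • y) * hxU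
  have hτv : τ₀ • (y * τ₀ • y) = y * τ₀ • y := by
    rw [smul_mul', flip_smul_flip_smul hτ₀ hτ₀t hyL, mul_comm]
  have hτyR : ∀ h ∈ localSubgroup (κ.layerSubgroup (n + (R + k))) (v.adicCompletion ℚ), h • t = t →
      h • (τ₀ • y) = τ₀ • y :=
    smul_mem_of_forall_mem_smul_eq ht _ hyR τ₀
  have hvR : ∀ h ∈ localSubgroup (κ.layerSubgroup (n + (R + k))) (v.adicCompletion ℚ),
      h • (y * τ₀ • y) = y * τ₀ • y := by
    intro h hh
    rcases ht h with hht | hht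
    · rw [smul_mul', hyR h hh hht, hτyR h hh hht]
    · -- `h = τ₀ · (τ₀⁻¹ h)` with `τ₀⁻¹ h ∈ H_{n+R+k} ∩ Stab(t)`
      have hmem : τ₀⁻¹ * h ∈ localSubgroup (κ.layerSubgroup (n + (R + k))) (v.adicCompletion ℚ) :=
        Subgroup.mul_mem _ (Subgroup.inv_mem _ (hile _ hτ₀)) hh
      have hfix : (τ₀⁻¹ * h) • t = t := by
        rw [mul_smul, hht, smul_neg, inv_smul_eq_smul_of_smul_eq_or (Or.inr hτ₀t), hτ₀t, neg_neg]
      have h1 : (τ₀⁻¹ * h) • (y * τ₀ • y) = y * τ₀ • y := by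
        rw [smul_mul', hyR _ hmem hfix, hτyR _ hmem hfix]
      rw [mul_smul, inv_smul_eq_iff] at h1
      rw [h1, hτv]
  have hgiv : ∀ i : ℕ, (g ^ i) • (y * τ₀ • y) = y * τ₀ • y := fun i ↦ pow_smul_eq_of_smul_eq g hgv i
  refine ⟨y, hy0, hyL, hxy, mul_ne_zero hy0 hτy0, fun h hh ↦ ?_⟩
  obtain ⟨i, -, hi⟩ := exists_pow_inv_mul_mem_localSubgroup_layerSubgroup (κ := κ) v n (R + k) hug hh
  have h1 := hvR _ hi
  rw [mul_smul, inv_smul_eq_iff, hgiv] at h1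
  exact h1

end Summit.BirchSwinnertonDyer.BirchSwinnertonDyer.Theorems.MultTowerNS2

end
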